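import Summits.AtomisticToContinuum.Crystallization.Theorems.FrustratedLawDichotomyStrainedPatchCoverBridgeA

/-!
# Strained patch · «CoverBridge» (lens-5 g81: the kinematic coarse cover (K), the bridge Refine (D), shadows, junctions, cell shapes) — part 2 of 2 (sequel of `…FrustratedLawDichotomyStrainedPatchCoverBridgeA`)

Split for the 400-line cap by the landing lane (hand-2 g34); the module docstring of part 1 (`…FrustratedLawDichotomyStrainedPatchCoverBridgeA`) describes the whole node.  Same namespace; all FQNs unchanged.
0 sorry; standard axioms.
-/

noncomputable section

namespace Summit.AtomisticToContinuum.Crystallization.Theorems.FrustratedLawDichotomyStrainedPatchCoverBridge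

open scoped BigOperators Classical
open Summit.AtomisticToContinuum.Crystallization.Theorems.ChargedEnergyGapNegative (eStar E3)
open Summit.AtomisticToContinuum.Crystallization.Theorems.FrustratedLawDichotomyRangeCut
open Summit.AtomisticToContinuum.Crystallization.Theorems.FrustratedLawDichotomySchurCut
open Summit.AtomisticToContinuum.Crystallization.Theorems.FrustratedLawDichotomyMotifLemmas (GoodAtScale)
open Summit.AtomisticToContinuum.Crystallization.Theorems.FrustratedLawDichotomyExemptLocOpt (LocOptFails)
open Summit.AtomisticToContinuum.Crystallization.Theorems.FrustratedLawDichotomyExemptSplit (SchurElasticPricingX)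
open Summit.AtomisticToContinuum.Crystallization.Theorems.FrustratedLawDichotomyExemptAbsorptionRecord
open Summit.AtomisticToContinuum.Crystallization.Theorems.FrustratedLawDichotomyCollarCensus
open Summit.AtomisticToContinuum.Crystallization.Theorems.FrustratedLawDichotomyCollarCensusKappa
open Summit.AtomisticToContinuum.Crystallization.Theorems.FrustratedLawDichotomyStrainedPatchHomSplit
open Summit.AtomisticToContinuum.Crystallization.Theorems.FrustratedLawDichotomyStrainedPatchCleanCollar (CleanBall TailPenalty AnnularDefectFloor
  DefectiveCollarFloor)
open Summit.AtomisticToContinuum.Crystallization.Theorems.FrustratedLawDichotomyStrainedPatchPhaseCut (MonoPhaseBall AnnularPhaseFloor PolyTextureFloor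
  monoPhaseBall_comp_iff)
open Summit.AtomisticToContinuum.Crystallization.Theorems.FrustratedLawDichotomyStrainedPatchCoreTube (NearHomIsoAt CoreOffTubeFloor nearHomIsoAt_comp_iff)
open Summit.AtomisticToContinuum.Crystallization.Theorems.FrustratedLawDichotomyStrainedPatchCoreTubeRecord (CoreCoreRelief)
open Summit.AtomisticToContinuum.Crystallization.Theorems.FrustratedLawDichotomyStrainedPatchHomIsometry (admissible_comp_iff goodAtScale_comp_iff
  dist_comp injective_comp_iff)
open Summit.AtomisticToContinuum.Crystallization.Theorems.FrustratedLawDichotomyStrainedPatchHomTubeIso (cleanBall_comp_iff)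
open Summit.AtomisticToContinuum.Crystallization.Theorems.FrustratedLawDichotomyStrainedPatchChartFamilies (ChartBy FamilyLE familyLE_refl
  ChartBy.mono_t ChartBy.mono_family)
open Summit.AtomisticToContinuum.Crystallization.Theorems.FrustratedLawDichotomyStrainedPatchChartFamiliesBent (homFamily IsBentBall bentFamily)
open Summit.AtomisticToContinuum.Crystallization.Theorems.FrustratedLawDichotomyStrainedPatchChartFamiliesPinned (polyBends bends0)
open Summit.AtomisticToContinuum.Crystallization.Theorems.FrustratedLawDichotomyStrainedPatchWindowFamilies (AdmissibleW bentFamilyW)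
open Summit.AtomisticToContinuum.Crystallization.Theorems.FrustratedLawDichotomyStrainedPatchHostCells (TubeFloor FamilyCover FamP dist_le_of_isHomBall)
open Summit.AtomisticToContinuum.Crystallization.Theorems.FrustratedLawDichotomyStrainedPatchQuantSlaving (ChartFam SlackTab)
open Summit.AtomisticToContinuum.Crystallization.Theorems.FrustratedLawDichotomyStrainedPatchGradedTube
open Summit.AtomisticToContinuum.Crystallization.Theorems.FrustratedLawDichotomyAperiodicGapRecordJunction
open Summit.AtomisticToContinuum.Crystallization.Theorems.FrustratedLawDichotomyAperiodicGapRecordJunctionGraded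
  (aperiodicFrustratedLawGap_of_homFloor_625_of_gradedTube periodicFrustratedLawGap_of_homFloor_625_of_gradedTube)

/-! ## §3. (K) THE KINEMATIC COARSE COVER and the SHADOW device (why (K) is weaker than the cover of record; the net reading) -/

/-- **`Shadows 𝓘 𝓘₀ τ τ₀ T T₀`** — every host of `𝓘` is SHADOWED by a host of `𝓘₀` on the SAME index type and centre index: positions relative to the
centre agree within the slacks `τ₀ − τ` and `T₀ − T` at every host site within `63/10 + τ` of the centre, and the shadow's `(63/10 − τ₀)`-ball lies
inside the host's `(63/10 − τ)`-ball.  (Two readings: a RICH family shadowed by a POOR one — bent hosts by their affine parts: (K) from the cover —;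
a CONTINUUM family shadowed by a finite NET at the cell slack — the census's cell model in graded currency.) -/
def Shadows (𝓘 𝓘₀ : ChartFam) (τ τ₀ : ℝ) (T T₀ : SlackTab) : Prop :=
  ∀ (M₁ : ℕ) (z₁ : Fin M₁ → E3) (c₁ : Fin M₁), 𝓘 M₁ z₁ c₁ → ∃ z₀ : Fin M₁ → E3, 𝓘₀ M₁ z₀ c₁ ∧
    (∀ b, dist (z₁ b) (z₁ c₁) ≤ 63 / 10 + τ →
      dist (z₁ b - z₁ c₁) (z₀ b - z₀ c₁) ≤ τ₀ - τ ∧ dist (z₁ b - z₁ c₁) (z₀ b - z₀ c₁) ≤ T₀ M₁ z₀ c₁ b - T M₁ z₁ c₁ b) ∧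
    (∀ b, dist (z₀ b) (z₀ c₁) ≤ 63 / 10 - τ₀ → dist (z₁ b) (z₁ c₁) ≤ 63 / 10 - τ)

section Shadow

variable {𝓘 𝓘₀ 𝓝 : ChartFam} {ρ ε η₂ τ τ₀ : ℝ} {T T₀ : SlackTab} {M : ℕ} {z : Fin M → E3} {c : Fin M} {M₁ : ℕ} {z₁ : Fin M₁ → E3} {c₁ : Fin M₁}
  {e : Fin M → Fin M₁}

/-- ★ **SHADOW TRANSFER of a graded chart**: a chart by a host of `𝓘` at `(τ, T)` is a chart by its shadow in `𝓘₀` at `(τ₀, T₀)`, SAME labelling.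
[folklore: two triangle inequalities] -/
theorem chartByG_shadow (hS : Shadows 𝓘 𝓘₀ τ τ₀ T T₀) (h : ChartByG 𝓘 τ T z c z₁ c₁ e) :
    ∃ z₀ : Fin M₁ → E3, ChartByG 𝓘₀ τ₀ T₀ z c z₀ c₁ e := by
  have hR : ∀ a, dist (z a) (z c) ≤ 63 / 10 → dist (z₁ (e a)) (z₁ c₁) ≤ 63 / 10 + τ := fun a ha => ChartByG.host_dist_le h ha
  obtain ⟨⟨hmem, hec, hco, _, hinj, hcov⟩, htab⟩ := h
  obtain ⟨z₀, hmem₀, hdev, hball⟩ := hS M₁ z₁ c₁ hmem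
  have key : ∀ a, dist (z a) (z c) ≤ 63 / 10 → dist (z a - z c) (z₀ (e a) - z₀ c₁) ≤ τ₀ ∧
      dist (z a - z c) (z₀ (e a) - z₀ c₁) ≤ T₀ M₁ z₀ c₁ (e a) := by
    intro a ha
    have htri := dist_triangle (z a - z c) (z₁ (e a) - z₁ c₁) (z₀ (e a) - z₀ c₁)
    have h1 := hco a ha
    have h2 := htab a ha
    obtain ⟨h3, h4⟩ := hdev (e a) (hR a ha)
    constructor <;> linarith
  refine ⟨z₀, ⟨hmem₀, hec, fun a ha => (key a ha).1, fun a ha _ => (key a ha).1, hinj, fun b₀ hb₀ => hcov b₀ (hball b₀ hb₀)⟩,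
    fun a ha => (key a ha).2⟩

/-- ★ (K) IS WEAKER THAN THE COVER whenever the coarse family shadows the fine one: `Shadows 𝓘 𝓘₀ τ τ₀ T T₀ → (BC-G)(𝓘, τ, T) → (BC-G)(𝓘₀, τ₀, T₀)`.
[folklore] -/
theorem familyCoverG_shadow (hS : Shadows 𝓘 𝓘₀ τ τ₀ T T₀) (h : FamilyCoverG 𝓘 ρ ε η₂ τ T) : FamilyCoverG 𝓘₀ ρ ε η₂ τ₀ T₀ := by
  intro M z c hz hcl hm hn hg
  obtain ⟨R, M₁, z₁, c₁, e, hch⟩ := h M z c hz hcl hm hn hg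
  obtain ⟨z₀, hch₀⟩ := chartByG_shadow hS hch
  exact ⟨R, M₁, z₀, c₁, e, hch₀⟩

/-- ★ THE NET READING: a graded certificate on the SHADOW family at the fattened data certifies the fine family at the tight data:
`Shadows 𝓘 𝓝 τ τ₀ T T₀ → (TF-G)(𝓝, τ₀, T₀) → (TF-G)(𝓘, τ, T)`. [folklore] -/
theorem tubeFloorG_shadow (hS : Shadows 𝓘 𝓝 τ τ₀ T T₀) (h : TubeFloorG 𝓝 τ₀ T₀) : TubeFloorG 𝓘 τ T := by
  intro M z c M₁ z₁ c₁ e hz hcl hm hch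
  obtain ⟨z₀, hch₀⟩ := chartByG_shadow hS hch
  exact h M z c M₁ z₀ c₁ e hz hcl hm hch₀

/-- A bridge into a shadowed family is a bridge into the shadow. [formal bookkeeping] -/
theorem Refine.shadow {𝓘c : ChartFam} {τc : ℝ} {Tc : SlackTab} (h : Refine 𝓘c 𝓘 ρ ε η₂ τc Tc τ T) (hS : Shadows 𝓘 𝓘₀ τ τ₀ T T₀) :
    Refine 𝓘c 𝓘₀ ρ ε η₂ τc Tc τ₀ T₀ := by
  intro M z c M₀ z₀ c₀ e hz hcl hm hn hg hch
  obtain ⟨R, M₁, z₁, c₁, e₁, hch₁⟩ := h M z c M₀ z₀ c₀ e hz hcl hm hn hg hch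
  obtain ⟨z₂, hch₂⟩ := chartByG_shadow hS hch₁
  exact ⟨R, M₁, z₂, c₁, e₁, hch₂⟩

end Shadow

/-! ### The instance of record: a bent host is shadowed by its underlying affine ball (crude global slack at the `133/10` radius) -/

/-- The crude bend slack at the full host radius: `q₂·(133/10)² + q₃·(133/10)³`. -/
def bendSlack (q₂ q₃ : ℝ) : ℝ := q₂ * (133 / 10) ^ 2 + q₃ * (133 / 10) ^ 3

/-- `bendSlack_nonneg` (docstring added by the landing lane; see the module docstring). [formal bookkeeping] -/
theorem bendSlack_nonneg {q₂ q₃ : ℝ} (h₂ : 0 ≤ q₂) (h₃ : 0 ≤ q₃) : 0 ≤ bendSlack q₂ q₃ := by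
  unfold bendSlack; positivity

/-- A degree-`≤ 3` bend moves a point of the `133/10`-ball by at most the crude slack. [formal bookkeeping] -/
theorem norm_bend_sub_le {q₂ q₃ : ℝ} (h₂ : 0 ≤ q₂) (h₃ : 0 ≤ q₃) {b : E3 → E3} (hb : b ∈ polyBends q₂ q₃) {v : E3} (hv : ‖v‖ ≤ 133 / 10) :
    ‖b v - v‖ ≤ bendSlack q₂ q₃ := by
  obtain ⟨Q, C, hQ, hC, hbv⟩ := hb
  have h0 : 0 ≤ ‖v‖ := norm_nonneg v
  have hvv : ‖v‖ * ‖v‖ ≤ 133 / 10 * (133 / 10) := mul_le_mul hv hv h0 (by norm_num)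
  have hvvv : ‖v‖ * ‖v‖ * ‖v‖ ≤ 133 / 10 * (133 / 10) * (133 / 10) := mul_le_mul hvv hv h0 (by norm_num)
  have hQ' : ‖Q v v‖ ≤ q₂ * (133 / 10) ^ 2 :=
    calc ‖Q v v‖ ≤ q₂ * ‖v‖ * ‖v‖ := hQ v v
      _ = q₂ * (‖v‖ * ‖v‖) := by ring
      _ ≤ q₂ * (133 / 10 * (133 / 10)) := mul_le_mul_of_nonneg_left hvv h₂
      _ = q₂ * (133 / 10) ^ 2 := by ring
  have hC' : ‖C v v v‖ ≤ q₃ * (133 / 10) ^ 3 :=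
    calc ‖C v v v‖ ≤ q₃ * ‖v‖ * ‖v‖ * ‖v‖ := hC v v v
      _ = q₃ * (‖v‖ * ‖v‖ * ‖v‖) := by ring
      _ ≤ q₃ * (133 / 10 * (133 / 10) * (133 / 10)) := mul_le_mul_of_nonneg_left hvvv h₃
      _ = q₃ * (133 / 10) ^ 3 := by ring
  have hb' : b v - v = Q v v + C v v v := by rw [hbv v]; abel
  rw [hb', bendSlack]
  exact (norm_add_le _ _).trans (add_le_add hQ' hC')

/-- ★ **THE SHADOW OF RECORD**: the window-honest bent family over `polyBends q₂ q₃` is shadowed by `latFamily` at the crude slack (constant tables).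
Each bent host `z₁ = c₁ + b(z₀ − c₁)` is shadowed by its own homogeneous ball `z₀` (injective because `z₁` is). [folklore] -/
theorem shadows_bentFamilyW_latFamily {q₂ q₃ η₃ τ : ℝ} (h₂ : 0 ≤ q₂) (h₃ : 0 ≤ q₃) :
    Shadows (bentFamilyW (polyBends q₂ q₃) η₃) latFamily τ (τ + bendSlack q₂ q₃) (constTol τ) (constTol (τ + bendSlack q₂ q₃)) := by
  intro M₁ z₁ c₁ hmem
  obtain ⟨hadm, ⟨b, z₀, hb, hH, hbent⟩, -⟩ := hmem
  have hinj₁ : Function.Injective z₁ := hadm.1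
  have hdev : ∀ a, dist (z₁ a - z₁ c₁) (z₀ a - z₀ c₁) ≤ bendSlack q₂ q₃ := by
    intro a
    rw [dist_eq_norm, hbent a]
    exact norm_bend_sub_le h₂ h₃ hb (by rw [← dist_eq_norm]; exact dist_le_of_isHomBall hH a)
  refine ⟨z₀, ⟨fun a a' haa => hinj₁ ?_, hH⟩, fun a _ => ⟨by linarith [hdev a], by rw [constTol_apply, constTol_apply]; linarith [hdev a]⟩,
    fun a ha => ?_⟩
  · -- injectivity of the shadow from injectivity of the bent host
    have h1 : z₁ a - z₁ c₁ = z₁ a' - z₁ c₁ := by rw [hbent a, hbent a', haa]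
    exact sub_left_injective h1
  · -- the shadow's `(63/10 − τ − slack)`-ball lies inside the host's `(63/10 − τ)`-ball
    have h1 : dist (z₁ a) (z₁ c₁) ≤ dist (z₀ a) (z₀ c₁) + dist (z₁ a - z₁ c₁) (z₀ a - z₀ c₁) := by
      rw [dist_eq_norm (z₁ a), dist_eq_norm (z₀ a), dist_eq_norm]
      calc ‖z₁ a - z₁ c₁‖ = ‖(z₀ a - z₀ c₁) + ((z₁ a - z₁ c₁) - (z₀ a - z₀ c₁))‖ := by rw [add_sub_cancel]
        _ ≤ ‖z₀ a - z₀ c₁‖ + ‖(z₁ a - z₁ c₁) - (z₀ a - z₀ c₁)‖ := norm_add_le _ _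
    linarith [hdev a]

/-- ★ **(K_lat) IS WEAKER THAN THE SCALAR COVER OF RECORD**: the cover by the bent family of record at scalar `τ` gives the graded cover by `latFamily`
at the crude kinematic data `τ + bendSlack (1/200) (1/2000)` (constant table). [folklore] -/
theorem familyCoverG_latFamily_of_cover_famP {ρ ε η₂ τ : ℝ} (h : FamilyCover FamP ρ ε η₂ τ) :
    FamilyCoverG latFamily ρ ε η₂ (τ + bendSlack (1 / 200) (1 / 2000)) (constTol (τ + bendSlack (1 / 200) (1 / 2000))) :=
  familyCoverG_shadow (shadows_bentFamilyW_latFamily (η₃ := 1 / 8) (by norm_num) (by norm_num)) (familyCoverG_constTol_iff.2 h)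

/-! ## §4. The junctions: [CORE-FAR] and the crux BY NAME from (TF-G) ∧ (K) ∧ (D) (and the net form) -/

section Junction

variable {𝓘₀ 𝓘 𝓝 : ChartFam} {ρ ε τ₀ τ τ₁ : ℝ} {T₀ T T₁ : SlackTab}

/-- ★★★ **[CORE-FAR] FROM THE THREE LEAVES**: `(TF-G) TubeFloorG 𝓘 τ T → (K) FamilyCoverG 𝓘₀ ρ ε (1/8) τ₀ T₀ → (D) Refine 𝓘₀ 𝓘 ρ ε (1/8) τ₀ T₀ τ T →
CoreOffTubeFloor (63/10) (63/10) ρ ε 0`. [folklore] -/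
theorem coreOff_of_tubeFloorG_of_coarse_of_refine (hT : TubeFloorG 𝓘 τ T) (hK : FamilyCoverG 𝓘₀ ρ ε (1 / 8) τ₀ T₀)
    (hD : Refine 𝓘₀ 𝓘 ρ ε (1 / 8) τ₀ T₀ τ T) : CoreOffTubeFloor (63 / 10) (63 / 10) ρ ε 0 :=
  coreOff_of_tubeFloorG_of_coverG_eighth hT (familyCoverG_of_coarse_of_refine hK hD)

/-- ★★ THE RECORD TARGET **[CORE-FAR] `CoreOffTubeFloor (63/10) (63/10) (24/5) (1/100) 0`** from the three leaves. [formal bookkeeping] -/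
theorem coreOff_record_of_coarse_of_refine (hT : TubeFloorG 𝓘 τ T) (hK : FamilyCoverG 𝓘₀ (24 / 5) (1 / 100) (1 / 8) τ₀ T₀)
    (hD : Refine 𝓘₀ 𝓘 (24 / 5) (1 / 100) (1 / 8) τ₀ T₀ τ T) : CoreOffTubeFloor (63 / 10) (63 / 10) (24 / 5) (1 / 100) 0 :=
  coreOff_of_tubeFloorG_of_coarse_of_refine hT hK hD

/-- ★★ THE NET FORM (finite range in HOST space): a graded certificate on a net `𝓝` at fattened data, the shadowing of `𝓘` by `𝓝`, the coarse cover and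
the bridge give [CORE-FAR]. [folklore] -/
theorem coreOff_of_net_of_shadow_of_coarse_of_refine (hN : TubeFloorG 𝓝 τ₁ T₁) (hS : Shadows 𝓘 𝓝 τ τ₁ T T₁)
    (hK : FamilyCoverG 𝓘₀ ρ ε (1 / 8) τ₀ T₀) (hD : Refine 𝓘₀ 𝓘 ρ ε (1 / 8) τ₀ T₀ τ T) : CoreOffTubeFloor (63 / 10) (63 / 10) ρ ε 0 :=
  coreOff_of_tubeFloorG_of_coarse_of_refine (tubeFloorG_shadow hS hN) hK hD

/-- ★★★ **THE CRUX BY NAME (27623)** from the record data of `…RecordJunctionGraded` with the cover leaf CUT: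
`… ∧ (TF-G) TubeFloorG 𝓘 τ T ∧ (K) FamilyCoverG 𝓘₀ (24/5) (1/100) (1/8) τ₀ T₀ ∧ (D) Refine 𝓘₀ 𝓘 (24/5) (1/100) (1/8) τ₀ T₀ τ T ∧ … ⟹ AperiodicFrustratedLawGap`,
for EVERY pair of families, scalars and tables. [folklore instantiation] -/
theorem aperiodicFrustratedLawGap_of_homFloor_625_of_coverBridge {εE CE DE DX : ℝ}
    (hε0 : 0 < εE) (hε1 : εE ≤ 1 / 10000) (hU : PeriodicEnergyCeiling (-(7175 / 10000))) (hDX : 0 ≤ DX)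
    (hE : SchurElasticPricingX (1 / 20) (1 / 8) w₄₅ ω₄ (3 / 400) (-(7175 / 10000)) (1 / 10000) CE DE DX (LocOptFails eStar εE (3 / 2) 1))
    (hHF : HomFloor (1 / 625)) (hT : TailPenalty (24 / 5) (1 / 1000)) (hRl : CoreCoreRelief (63 / 10) (63 / 10) (24 / 5) (1 / 100) (3 / 5000))
    (hTF : TubeFloorG 𝓘 τ T) (hK : FamilyCoverG 𝓘₀ (24 / 5) (1 / 100) (1 / 8) τ₀ T₀) (hBr : Refine 𝓘₀ 𝓘 (24 / 5) (1 / 100) (1 / 8) τ₀ T₀ τ T)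
    (hF : AnnularPhaseFloor (63 / 10) (24 / 5) (63 / 10) (1 / 1000))
    (hP : PolyTextureFloor (63 / 10) (24 / 5) (1 / 1000)) (hA : AnnularDefectFloor (24 / 5) (63 / 10)) (hD : DefectiveCollarFloor (24 / 5))
    (h2 : CrowdedCoreMotifPricingCapK (1 / 1000) (9 / 5) (133 / 10) (3 / 2) (effPot w₄₅ ω₄ (3 / 400)) (-(7175 / 10000) + 3 / 400)
      (Collar (9 / 2) fun N y j => (∃ s : ℝ, 0 ≤ s ∧ s ≤ 3 / 2 ∧ NonEquilibriumCore (-(7175 / 10000)) 0 7 s (1 / 10000) N y j) ∨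
        GoodAtScale (1 / 20) (3 / 2) y j))
    (h3 : DiluteDefectMotifPricingCapK (1 / 1000) (9 / 5) (133 / 10) (3 / 2) (effPot w₄₅ ω₄ (3 / 400)) (-(7175 / 10000) + 3 / 400)
      (Collar (9 / 2) fun N y j => (∃ s : ℝ, 0 ≤ s ∧ s ≤ 3 / 2 ∧ NonEquilibriumCore (-(7175 / 10000)) 0 7 s (1 / 10000) N y j) ∨
        GoodAtScale (1 / 20) (3 / 2) y j)) :
    Summit.AtomisticToContinuum.Crystallization.Theses.FrustratedLawDichotomy.AperiodicFrustratedLawGap :=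
  aperiodicFrustratedLawGap_of_homFloor_625_of_gradedTube hε0 hε1 hU hDX hE hHF hT hRl hTF (familyCoverG_of_coarse_of_refine hK hBr) hF hP hA hD h2 h3

/-- ★★ **Periodic sibling (27624)** with the cover leaf cut. [folklore instantiation] -/
theorem periodicFrustratedLawGap_of_homFloor_625_of_coverBridge {εE CE DE DX : ℝ}
    (hε0 : 0 < εE) (hε1 : εE ≤ 1 / 10000) (hU : PeriodicEnergyCeiling (-(7175 / 10000))) (hDX : 0 ≤ DX)
    (hE : SchurElasticPricingX (1 / 20) (1 / 8) w₄₅ ω₄ (3 / 400) (-(7175 / 10000)) (1 / 10000) CE DE DX (LocOptFails eStar εE (3 / 2) 1))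
    (hHF : HomFloor (1 / 625)) (hT : TailPenalty (24 / 5) (1 / 1000)) (hRl : CoreCoreRelief (63 / 10) (63 / 10) (24 / 5) (1 / 100) (3 / 5000))
    (hTF : TubeFloorG 𝓘 τ T) (hK : FamilyCoverG 𝓘₀ (24 / 5) (1 / 100) (1 / 8) τ₀ T₀) (hBr : Refine 𝓘₀ 𝓘 (24 / 5) (1 / 100) (1 / 8) τ₀ T₀ τ T)
    (hF : AnnularPhaseFloor (63 / 10) (24 / 5) (63 / 10) (1 / 1000))
    (hP : PolyTextureFloor (63 / 10) (24 / 5) (1 / 1000)) (hA : AnnularDefectFloor (24 / 5) (63 / 10)) (hD : DefectiveCollarFloor (24 / 5))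
    (h2 : CrowdedCoreMotifPricingCapK (1 / 1000) (9 / 5) (133 / 10) (3 / 2) (effPot w₄₅ ω₄ (3 / 400)) (-(7175 / 10000) + 3 / 400)
      (Collar (9 / 2) fun N y j => (∃ s : ℝ, 0 ≤ s ∧ s ≤ 3 / 2 ∧ NonEquilibriumCore (-(7175 / 10000)) 0 7 s (1 / 10000) N y j) ∨
        GoodAtScale (1 / 20) (3 / 2) y j))
    (h3 : DiluteDefectMotifPricingCapK (1 / 1000) (9 / 5) (133 / 10) (3 / 2) (effPot w₄₅ ω₄ (3 / 400)) (-(7175 / 10000) + 3 / 400)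
      (Collar (9 / 2) fun N y j => (∃ s : ℝ, 0 ≤ s ∧ s ≤ 3 / 2 ∧ NonEquilibriumCore (-(7175 / 10000)) 0 7 s (1 / 10000) N y j) ∨
        GoodAtScale (1 / 20) (3 / 2) y j)) :
    Summit.AtomisticToContinuum.Crystallization.Theses.FrustratedLawDichotomy.PeriodicFrustratedLawGap :=
  periodicFrustratedLawGap_of_homFloor_625_of_gradedTube hε0 hε1 hU hDX hE hHF hT hRl hTF (familyCoverG_of_coarse_of_refine hK hBr) hF hP hA hD h2 h3

end Junction

/-! ## §5. The pre-registered cell SHAPES (Lean fixes shapes, the census fixes numbers — memo NODE-g81 §3) -/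

section Cells

/-- ★ **POLY-BRIDGE CELL** (K_poly): fine family `FamP`, scalar `τ₀` (= the conceded rim value), three-level profile `step3Tol Rc Rm τin τmid τ₀`;
coarse = the SAME family at its kinematic envelope `constTol τ₀` (= the SCALAR cover of record at `τ₀`).  [CORE-FAR] at the record dials. [formal bookkeeping] -/
theorem coreOff_record_of_polyBridge (Rc Rm τin τmid τ₀ : ℝ) (hT : TubeFloorG FamP τ₀ (step3Tol Rc Rm τin τmid τ₀))
    (hK : FamilyCover FamP (24 / 5) (1 / 100) (1 / 8) τ₀)
    (hD : Refine FamP FamP (24 / 5) (1 / 100) (1 / 8) τ₀ (constTol τ₀) τ₀ (step3Tol Rc Rm τin τmid τ₀)) :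
    CoreOffTubeFloor (63 / 10) (63 / 10) (24 / 5) (1 / 100) 0 :=
  coreOff_record_of_coarse_of_refine hT (familyCoverG_constTol_iff.2 hK) hD

/-- ★ The poly-bridge cell is an EXACT CUT of the graded cover of the U-cell it refines: for `τin, τmid ≤ τ₀`,
`FamilyCoverG FamP … τ₀ (step3Tol Rc Rm τin τmid τ₀) ↔ FamilyCover FamP … τ₀ ∧ Refine FamP FamP … τ₀ (constTol τ₀) τ₀ (step3Tol …)`. [folklore] -/
theorem familyCoverG_poly_iff (ρ ε η₂ : ℝ) {Rc Rm τin τmid τ₀ : ℝ} (h₁ : τin ≤ τ₀) (h₂ : τmid ≤ τ₀) :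
    FamilyCoverG FamP ρ ε η₂ τ₀ (step3Tol Rc Rm τin τmid τ₀) ↔
      FamilyCover FamP ρ ε η₂ τ₀ ∧ Refine FamP FamP ρ ε η₂ τ₀ (constTol τ₀) τ₀ (step3Tol Rc Rm τin τmid τ₀) := by
  rw [← familyCoverG_constTol_iff]
  exact familyCoverG_iff_coarse_and_refine (familyLE_refl FamP) (tolLE_step3Tol_const h₁ h₂ le_rfl) le_rfl

/-- ★ **LAT-BRIDGE CELL** (K_lat): coarse family `latFamily` at a kinematic table `T₀` (shape `quadTol a q`, census AFFENV-81), fine family `FamP` at the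
three-level profile. [formal bookkeeping] -/
theorem coreOff_record_of_latBridge (T₀ : SlackTab) (Rc Rm τin τmid τ₀ : ℝ) (hT : TubeFloorG FamP τ₀ (step3Tol Rc Rm τin τmid τ₀))
    (hK : FamilyCoverG latFamily (24 / 5) (1 / 100) (1 / 8) τ₀ T₀)
    (hD : Refine latFamily FamP (24 / 5) (1 / 100) (1 / 8) τ₀ T₀ τ₀ (step3Tol Rc Rm τin τmid τ₀)) :
    CoreOffTubeFloor (63 / 10) (63 / 10) (24 / 5) (1 / 100) 0 :=
  coreOff_record_of_coarse_of_refine hT hK hD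

/-- RECOVERY of the U-cell of record (uniform `τ`): the bridge leaf is discharged by `refine_self`, the coarse leaf is the scalar cover, and the
three-level profile at equal values is the constant table — i.e. U125-E1 is the degenerate cell `Rc = Rm = ∞`. [formal bookkeeping] -/
theorem coreOff_record_of_uniform (τ : ℝ) (hT : TubeFloor FamP τ) (hK : FamilyCover FamP (24 / 5) (1 / 100) (1 / 8) τ) :
    CoreOffTubeFloor (63 / 10) (63 / 10) (24 / 5) (1 / 100) 0 :=
  coreOff_record_of_coarse_of_refine (tubeFloorG_constTol_iff.2 hT) (familyCoverG_constTol_iff.2 hK) (refine_self FamP _ _ _ τ (constTol τ))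

/-- RECOVERY of g77's two-level graded cell: `step3Tol Rc Rm τin τ₀ τ₀ = gradeTol Rc τin τ₀`. [formal bookkeeping] -/
theorem coreOff_record_of_polyBridge_twoLevel (Rc Rm τin τ₀ : ℝ) (hT : TubeFloorG FamP τ₀ (gradeTol Rc τin τ₀))
    (hK : FamilyCover FamP (24 / 5) (1 / 100) (1 / 8) τ₀)
    (hD : Refine FamP FamP (24 / 5) (1 / 100) (1 / 8) τ₀ (constTol τ₀) τ₀ (gradeTol Rc τin τ₀)) :
    CoreOffTubeFloor (63 / 10) (63 / 10) (24 / 5) (1 / 100) 0 := by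
  rw [← step3Tol_of_mid_eq Rc Rm] at hT hD
  exact coreOff_record_of_polyBridge Rc Rm τin τ₀ τ₀ hT hK hD

end Cells

end Summit.AtomisticToContinuum.Crystallization.Theorems.FrustratedLawDichotomyStrainedPatchCoverBridge

end
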